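import Summits.ResolutionOfSingularities.ResolutionOfSingularities.Theses.Descent
import Summits.ResolutionOfSingularities.ResolutionOfSingularities.Theses.EscapeRate
import Summits.ResolutionOfSingularities.ResolutionOfSingularities.Theses.WildQuotients
import Summits.ResolutionOfSingularities.ResolutionOfSingularities.Theorems.WeightedInvariantDescentPerfectToAllPicoverLink
import Summits.ResolutionOfSingularities.ResolutionOfSingularities.Theorems.PAlterationPicoverGiraudSepReduction
import Literature.AlgebraicGeometry.Resolution.LogRegularResolutionGeneralHolds
import HarnessLib

/-!
# Crux `DescentPerfectToAll` (stmt-ResolutionOfSingularities-0549): the line `via-giraud-sep` with its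
# literature stub DISCHARGED — `GiraudNormalFormSep → Picover → DescentPerfectToAll`, sorry-free

The registered skeleton `Cruxes/DescentPerfectToAll/Lines/via_giraud_sep.lean` (strategist s1, 2026-08-17)
reduces the crux to two stubs: the research statement `stub_giraudNormalFormSep` (= item
stmt-ResolutionOfSingularities-18001, `WildQuotients.GiraudNormalFormSep`, verbatim) and the named fact
`stub_kato1994LogRegularGeneral : Kato1994_logRegular_hasResolution_general` (Kato 1994 (10.4), atlas form).
The second is now a THEOREM of the tree (`Kato1994_logRegular_hasResolution_general_holds`,
`Literature/AlgebraicGeometry/Resolution/LogRegularResolutionGeneralHolds.lean`, seat res-L0-w81-pv-2 g2 with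
res-lit-3 / res-type-037 / res-type-043, 2026-08-27), so this file lands that stub BY NAME AND SIGNATURE and records the line's composition WITHOUT the Kato
hypothesis:

* `stub_kato1994LogRegularGeneral : Kato1994_logRegular_hasResolution_general.{0}` — the registered stub, proved;
* `picover_of_giraudNormalFormSep` — `WildQuotients.GiraudNormalFormSep → PAlteration.Picover`
  (the 0554 bridge `Picover.GiraudSepReduction.picover_of_giraudNormalFormSep_of_kato` fed with the Kato theorem);
* `descentPerfectToAll_of_giraudNormalFormSep` — `WildQuotients.GiraudNormalFormSep → Descent.DescentPerfectToAll`
  (through `descentPerfectToAll_of_picover`, p113743), and the `EscapeRate` / `WeightedInvariant` copies.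

After this file the ONLY open input of the line `via-giraud-sep` is item 18001 (Giraud's normal form for a
height-one purely inseparable class on a separated regular base, all fields, all dimensions; printed for
`dim W ≤ 3`, open for `dim W ≥ 4` — `Literature.Barriers.ResolutionOfSingularities.DimensionFourFrontier`).
Nothing here is new mathematics; the crux and item 18001 remain open.
-/

noncomputable section

set_option linter.dupNamespace false -- mandated namespace of this single-conjunct summit

open CategoryTheory AlgebraicGeometry
open Literature.AlgebraicGeometry.Resolution

namespace Summit.ResolutionOfSingularities.ResolutionOfSingularities.Theorems

/-- **The registered stub `stub_kato1994LogRegularGeneral` of the line `via-giraud-sep`, BY NAME AND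
SIGNATURE**: Kato 1994 (10.4), atlas form — a scheme carrying a log regular Zariski fs atlas has a resolution
of singularities. Discharged by the tree's theorem `Kato1994_logRegular_hasResolution_general_holds`
(linked KKMS regular refinement of the face fans + the scheme-side assembly). [cite: Kato1994, (10.4)] -/
theorem stub_kato1994LogRegularGeneral :
    Literature.AlgebraicGeometry.Resolution.Kato1994_logRegular_hasResolution_general.{0} :=
  Kato1994_logRegular_hasResolution_general_holds.{0}

/-- **`GiraudNormalFormSep ⇒ Picover`, unconditionally.** Giraud's normal form for the class of a purely
inseparable degree-`p` extension on a separated regular base (item stmt-18001, all fields and dimensions)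
implies crux `Picover` (stmt-0554): the landed bridge `picover_of_giraudNormalFormSep_of_kato` with its
Kato 1994 (10.4) hypothesis discharged by `Kato1994_logRegular_hasResolution_general_holds`. [folklore] -/
theorem picover_of_giraudNormalFormSep
    (hG : Summit.ResolutionOfSingularities.ResolutionOfSingularities.Theses.WildQuotients.GiraudNormalFormSep) :
    Summit.ResolutionOfSingularities.ResolutionOfSingularities.Theses.PAlteration.Picover :=
  Picover.GiraudSepReduction.picover_of_giraudNormalFormSep_of_kato hG stub_kato1994LogRegularGeneral

/-- **`GiraudNormalFormSep ⇒ DescentPerfectToAll`** (item 18001 ⇒ crux stmt-0549, the route's own decl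
`Descent.DescentPerfectToAll`): Giraud normal form ⇒ `Picover` (above) ⇒ the crux
(`descentPerfectToAll_of_picover`: robust separable model, iterated one-root reduction, `Picover` as the
radicial bottom). The line `via-giraud-sep` with its literature stub discharged. [folklore] -/
theorem descentPerfectToAll_of_giraudNormalFormSep
    (hG : Summit.ResolutionOfSingularities.ResolutionOfSingularities.Theses.WildQuotients.GiraudNormalFormSep) :
    Summit.ResolutionOfSingularities.ResolutionOfSingularities.Theses.Descent.DescentPerfectToAll :=
  fun p hp H => descentPerfectToAll_of_picover (picover_of_giraudNormalFormSep hG) p hp H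

/-- Same implication, concluding the `EscapeRate` copy of the crux (the bet route of the registered
skeleton `via_giraud_sep`). [folklore] -/
theorem escapeRate_descentPerfectToAll_of_giraudNormalFormSep
    (hG : Summit.ResolutionOfSingularities.ResolutionOfSingularities.Theses.WildQuotients.GiraudNormalFormSep) :
    Summit.ResolutionOfSingularities.ResolutionOfSingularities.Theses.EscapeRate.DescentPerfectToAll :=
  fun p hp H => descentPerfectToAll_of_picover (picover_of_giraudNormalFormSep hG) p hp H

/-- Same implication, concluding the `WeightedInvariant` copy of the crux (the target of the landed edge
`descentPerfectToAll_of_picover`, p113743). [folklore] -/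
theorem weightedInvariant_descentPerfectToAll_of_giraudNormalFormSep
    (hG : Summit.ResolutionOfSingularities.ResolutionOfSingularities.Theses.WildQuotients.GiraudNormalFormSep) :
    Summit.ResolutionOfSingularities.ResolutionOfSingularities.Theses.WeightedInvariant.DescentPerfectToAll :=
  descentPerfectToAll_of_picover (picover_of_giraudNormalFormSep hG)

end Summit.ResolutionOfSingularities.ResolutionOfSingularities.Theorems

end
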